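import Summits.CriticalPhenomena.SAWScalingLimit.Theorems.SAWLoopFugacityFlowIsingBoundaryRatioWindowExtResistanceSide
import Summits.CriticalPhenomena.SAWScalingLimit.Theorems.SAWLoopFugacityFlowIsingBoundaryRatioWindowExtResistanceLength
import Summits.CriticalPhenomena.SAWScalingLimit.Theorems.SAWLoopFugacityFlowIsingBoundaryRatioWindowExtResistanceMetric
import Summits.CriticalPhenomena.SAWScalingLimit.Theorems.SAWLoopFugacityFlowIsingBoundaryRatioWindowExtResistanceAveraging
import HarnessLib

/-!
# The resistance bound for the window rectangle (`WindowExtResistanceBound`, PROVED)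
(line `fk-anchor-transfer`, crux `SAWLoopFugacityFlow.IsingBoundaryRatio`, stmt-CriticalPhenomena-10650; registered
stub `windowExtResistanceBound_holds : WindowExtResistanceBound`, statement in
`…IsingBoundaryRatioWindowResistanceDefs.lean`)

**Theorem** (`windowExtResistanceBound_holds`). For the chordal chart `φ` of a Dobrushin domain `(D; a, b)`
there is `C` (here `C = 3.2·10⁶`) such that for every `M > 1`, `ε > 0` there is `ρ₀ > 0` with: for every
scale `ρ < ρ₀`, all radii `ρ < r₁ < r₁' < r₂' < r₂ < Mρ`, all small meshes `δ`, every finite volume `Λ`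
containing the chart disc of radius `Mρ`, and every presentation `IsWindowRect D φ M ε δ ρ r₁ r₂ r₁' r₂' Λ E d₀ n`
of the lattice window as a discrete topological rectangle, the unit-conductance resistance of the completed
network `Ω̄ = DiscreteRect.extGraph E` between the external arcs of the two rough sides satisfies
`ℓ_Ω̄[(arc 0)_ext, (arc 2)_ext] ≤ C / log (r₂'/r₁')` — the discrete counterpart of the extremal distance
`π / log (r₂'/r₁')` of the conformal half-annulus, with `C` independent of the modulus.

This is the elementary direction (i) of D. Chelkak, *Robust discrete complex analysis: a toolbox*, Ann.
Probab. 44 (2016), Prop. 6.2 ("`L_cont ≥ const · L_disc`"), carried out for the relatively closed window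
rectangles of the line. Proof (modules `…WindowExtResistance{Cells,Block,Extract,Metric,Length,Averaging,
Chart,Side}.lean`):

1. By Duffin's theorem (`extremalLength_eq_effectiveResistance`, `EffectiveResistance.lean`) the resistance
   is `sup_W dist_W(arcs)² / Σ_e W(e)²` over edge metrics `W`, so it suffices to show
   `dist_W² ≤ (C / log) · Σ_e W(e)²` for every `W`.
2. `ρ₀`: the chart half-disc of radius `Mρ₀` is mapped by `φ` into `B(a, ε)` (`φ → a` at `0`). Margin
   `m = min (r₁'/8) ((r₂' - r₁')/16)`, so that `log (r₂' - 2m) - log (r₁' + 2m) ≥ ½ log (r₂'/r₁')`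
   (`wer_log_margin`). Small `δ`: the chart toolkit `wer_chart_setup` (`…Chart.lean`).
3. For every semicircle radius `r = e^s ∈ (r₁' + 2m, r₂' - 2m)` (`wer_edgeDist_mul_le_semicircle`): both
   ends of the chart semicircle `θ ↦ φ(r e^{iθ})` come within `δ/8` of `∂D` (`wer_exists_near_frontier`),
   and the face-chain extraction along each half (`wer_side_vertex`, `…Side.lean`, built on `wer_extraction`,
   `…Extract.lean`) yields boundary vertices `u_L`, `u_R` of `E` of inner chart radius with chart points of
   negative, resp. positive real part — on arc `0`, resp. arc `2`, by `IsWindowRect.arc0_sup/arc2_sup` — joined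
   through the top cell by a walk of `⟨E⟩` whose vertices are within `5δ` of the semicircle; with the two
   pendant edges (`IsExtDart.iterate`) this is a walk of `Ω̄` between the external arcs, and Chelkak's length
   comparison (`wer_edgeDist_mul_le`, `…Length.lean`) gives `dist_W · δ ≤ ∫₀^π ĝ(φ(re^{iθ})) |∂_θ φ(re^{iθ})| dθ`
   for the block metric `ĝ(z) = Σ_x w(x) 𝟙[dist(z, δx) ≤ 6δ]`, `w(x) = Σ_{e ∋ x} W(e)`.
4. Averaging over `s` against `ds` on the log-polar rectangle, the area formula for `φ ∘ exp` and
   Cauchy–Schwarz (`wer_sq_mul_le_lintegral_sq`, `…Averaging.lean`) give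
   `(dist_W δ)² · ½ log (r₂'/r₁') ≤ π ∬ ĝ²`, and the bounded overlap of the blocks
   (`wer_lintegral_sq_le`, `…Metric.lean`) gives `∬ ĝ² ≤ 4·10⁵ δ² Σ_e W(e)²`; hence
   `dist_W² ≤ 3.2·10⁶ / log (r₂'/r₁') · Σ_e W(e)²` (`π ≤ 4`).

References: D. Chelkak, Ann. Probab. 44 (2016), Prop. 6.2 (i); R. J. Duffin, J. Math. Anal. Appl. 5 (1962);
L. V. Ahlfors, *Conformal invariants* (1973), §4-2.
-/

noncomputable section

open scoped Classical Topology ENNReal NNReal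
open Filter Set Metric SimpleGraph MeasureTheory Complex
open Literature.Probability.LatticeModels Literature.Probability.RandomPlanarGeometry
open Literature.Probability.Percolation (BondConfig)
open UpperHalfPlane (upperHalfPlaneSet)

namespace Summit.CriticalPhenomena.SAWScalingLimit.Theorems.IsingBoundaryRatio

/-- **Resistance path along one chart semicircle**: under the standing chart hypotheses, for every edge
metric `W` of the completed graph `Ω̄` and every semicircle radius `e^s ∈ (r₁' + 2m, r₂' - 2m)`,
`dist_W((arc 0)_ext, (arc 2)_ext) · δ ≤ ∫₀^π ĝ(φ(e^{s+iθ})) |∂_θ φ(e^{s+iθ})| dθ`. [folklore] -/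
theorem wer_edgeDist_mul_le_semicircle {D : DobrushinDomain} {φ : ConformalEquiv upperHalfPlaneSet D.carrier}
    {M ε δ ρ r₁ r₂ r₁' r₂' : ℝ} {Λ : Finset (Site 2)} {E : Finset (Sym2 (Site 2))} {d₀ : Site 2 × Fin 4}
    {n : Fin 4 → ℕ} (hW : IsWindowRect D φ M ε δ ρ r₁ r₂ r₁' r₂' Λ E d₀ n)
    (hΛ : ∀ x ∈ meshDomain D.carrier δ, ‖φ.symm (meshPoint δ x)‖ < M * ρ → x ∈ Λ)
    {g : ℂ → ℂ} {B : Set ℂ} {η d m r₀ : ℝ} (hδ : 0 < δ)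
    (hgeq : EqOn g φ.symm D.carrier)
    (hgfr : ∀ z ∈ B, z ∈ frontier D.carrier → (g z).im = 0)
    (hmemB : ∀ z ∈ D.carrier, ‖φ.symm z‖ ≤ M * ρ → ∀ z' ∈ closure D.carrier, dist z' z ≤ d → z' ∈ B)
    (hηg : ∀ z ∈ B, ∀ z' ∈ B, dist z z' < η → dist (g z) (g z') < m)
    (hδη : 16 * δ < η) (hδd : 16 * δ < d)
    (hdeep : ∀ z ∈ D.carrier, ‖φ.symm z‖ ≤ M * ρ → m ≤ (φ.symm z).im → ∀ x : Site 2,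
      dist (meshPoint δ x) z ≤ 3 * δ → x ∈ meshDomain D.carrier δ ∧
        ∀ k : Fin 4, (discreteDomainGraph D.carrier δ).Adj x (x + DiscreteRect.dir k))
    (hball : ∀ w ∈ upperHalfPlaneSet, ‖w‖ < r₀ → φ w ∈ ball (D.pt 0) ε) (hMρ : M * ρ ≤ r₀)
    (h1 : ρ < r₁) (h1' : r₁ ≤ r₁') (h2' : r₂' ≤ r₂) (h2 : r₂ < M * ρ) (hm : 0 < m) (hmr : 8 * m ≤ r₁')
    {s : ℝ} (hs1 : r₁' + 2 * m < Real.exp s) (hs2 : Real.exp s < r₂' - 2 * m)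
    {F : Finset (Sym2 (Site 2 ⊕ Site 2 × Fin 4))} (hF : ∀ e ∈ (DiscreteRect.extGraph E).edgeSet, e ∈ F)
    (W : Sym2 (Site 2 ⊕ Site 2 × Fin 4) → ℝ≥0) :
    edgeDist (DiscreteRect.extGraph E) W (DiscreteRect.extArc E d₀ n 0) (DiscreteRect.extArc E d₀ n 2) *
        ENNReal.ofReal δ ≤
      ∫⁻ θ in Ioo 0 Real.pi, (∑ x ∈ DiscreteRect.verts E, (closedBall (meshPoint δ x) (6 * δ)).indicator
        (fun _ => ((∑ e ∈ F with Sum.inl x ∈ e, W e : ℝ≥0) : ℝ≥0∞)) (φ (exp ((s : ℂ) + (θ : ℂ) * I)))) *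
        ‖deriv (fun θ : ℝ => φ (exp ((s : ℂ) + (θ : ℂ) * I))) θ‖ₑ := by
  set r := Real.exp s with hr
  set γ : ℝ → ℂ := fun θ => φ (exp ((s : ℂ) + (θ : ℂ) * I)) with hγ
  have hπ := Real.pi_pos
  -- the two sides
  obtain ⟨⟨θb, hθb, pb, hpb, hpbe⟩, ⟨θa, hθa, pa, hpa, hpae⟩⟩ :=
    wer_exists_near_frontier φ s (show (0 : ℝ) < δ / 8 by positivity)
  obtain ⟨uL, hubL, hrL1, hrL2, hreL, -, wL, hwL⟩ := wer_side_vertex hW hΛ hδ hgeq hgfr hmemB hηg hδη hδd hdeep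
    hball hMρ h1 h1' h2' h2 hm hmr hs1 hs2 (half_pos hπ) le_rfl hθb.1.le hθb.2 (right_mem_Icc.2 hθb.1.le) hpb hpbe
  obtain ⟨uR, hubR, hrR1, hrR2, -, hreR, wR, hwR⟩ := wer_side_vertex hW hΛ hδ hgeq hgfr hmemB hηg hδη hδd hdeep
    hball hMρ h1 h1' h2' h2 hm hmr hs1 hs2 hθa.1 hθa.2.le le_rfl (by linarith [hθa.2])
    (left_mem_Icc.2 hθa.2.le) hpa hpae
  have hreL' : (φ.symm (meshPoint δ uL)).re < 0 := hreL fun θ hθ =>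
    Real.cos_nonpos_of_pi_div_two_le_of_le hθ.1 (by linarith [hθ.2, hθb.2])
  have hreR' : 0 < (φ.symm (meshPoint δ uR)).re := hreR fun θ hθ =>
    Real.cos_nonneg_of_mem_Icc ⟨by linarith [hθ.1, hθa.1], hθ.2⟩
  -- the arcs and the pendant edges
  obtain ⟨iL, hiL1, hiL2, hiL⟩ := hW.arc0_sup uL hubL hrL1 hrL2 hreL'
  obtain ⟨iR, hiR1, hiR2, hiR⟩ := hW.arc2_sup uR hubR hrR1 hrR2 hreR'
  set dL := (DiscreteRect.succ E)^[iL] d₀ with hdL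
  set dR := (DiscreteRect.succ E)^[iR] d₀ with hdR
  have hadjL : (DiscreteRect.extGraph E).Adj (Sum.inr dL) (Sum.inl uL) :=
    (DiscreteRect.extGraph_adj_inl_inr.2 ⟨hW.isRect.isExtDart.iterate iL, hiL⟩).symm
  have hadjR : (DiscreteRect.extGraph E).Adj (Sum.inl uR) (Sum.inr dR) :=
    DiscreteRect.extGraph_adj_inl_inr.2 ⟨hW.isRect.isExtDart.iterate iR, hiR⟩
  have hAL : Sum.inr dL ∈ DiscreteRect.extArc E d₀ n 0 := ⟨iL, hiL1, hiL2, rfl⟩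
  have hZR : Sum.inr dR ∈ DiscreteRect.extArc E d₀ n 2 := ⟨iR, hiR1, hiR2, rfl⟩
  -- the walk of `Ω̄`
  set f : fromEdgeSet (↑E : Set (Sym2 (Site 2))) →g DiscreteRect.extGraph E :=
    ⟨Sum.inl, fun h => DiscreteRect.extGraph_adj_inl_inl_iff_fromEdgeSet.2 h⟩ with hf
  set w₁ := (wL.reverse.append wR).map f with hw₁
  set p : (DiscreteRect.extGraph E).Walk (Sum.inr dL) (Sum.inr dR) := Walk.cons hadjL (w₁.concat hadjR) with hp
  have hnear : ∀ x : Site 2, Sum.inl x ∈ p.support → ∃ t ∈ Ioo 0 Real.pi, dist (γ t) (meshPoint δ x) ≤ 5 * δ := by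
    intro x hx
    rw [hp, Walk.support_cons, List.mem_cons, Walk.support_concat, List.mem_append, List.mem_singleton, hw₁,
      Walk.support_map, List.mem_map] at hx
    rcases hx with hx | ⟨y, hy, hyx⟩ | hx
    · exact absurd hx (by simp)
    · have hyx' : y = x := Sum.inl_injective hyx
      subst hyx'
      rw [Walk.mem_support_append_iff, Walk.support_reverse, List.mem_reverse] at hy
      rcases hy with hy | hy
      · exact hwL y hy
      · exact hwR y hy
    · exact absurd hx (by simp)
  -- the curve
  have hγc : ContinuousOn γ (Ioo 0 Real.pi) := by
    refine φ.continuousOn.comp (by fun_prop : Continuous fun θ : ℝ => exp ((s : ℂ) + (θ : ℂ) * I)).continuousOn ?_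
    exact fun θ hθ => wer_exp_mem_uhp s hθ
  have hγd : DifferentiableOn ℝ γ (Ioo 0 Real.pi) := by
    refine (φ.differentiableOn.restrictScalars ℝ).comp
      (by fun_prop : Differentiable ℝ fun θ : ℝ => exp ((s : ℂ) + (θ : ℂ) * I)).differentiableOn ?_
    exact fun θ hθ => wer_exp_mem_uhp s hθ
  have hfar : ∃ t₁ ∈ Ioo 0 Real.pi, ∃ t₂ ∈ Ioo 0 Real.pi, 12 * δ < dist (γ t₁) (γ t₂) := by
    have ht₁ : Real.pi / 2 ∈ Ioo 0 Real.pi := ⟨by positivity, by linarith⟩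
    have ht₂ : Real.pi / 6 ∈ Ioo 0 Real.pi := ⟨by positivity, by linarith⟩
    refine ⟨_, ht₁, _, ht₂, ?_⟩
    by_contra hle
    push Not at hle
    have hD : ∀ θ ∈ Ioo 0 Real.pi, γ θ ∈ D.carrier := fun θ hθ => φ.mapsTo (wer_exp_mem_uhp s hθ)
    have hsy : ∀ θ ∈ Ioo 0 Real.pi, φ.symm (γ θ) = exp ((s : ℂ) + (θ : ℂ) * I) := fun θ hθ =>
      φ.symm_apply_apply (wer_exp_mem_uhp s hθ)
    have hrad : ∀ θ ∈ Ioo 0 Real.pi, ‖φ.symm (γ θ)‖ ≤ M * ρ := fun θ hθ => by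
      rw [hsy θ hθ, (wer_exp_polar s θ).1]; linarith
    have hB₁ : γ (Real.pi / 2) ∈ B := hmemB _ (hD _ ht₁) (hrad _ ht₁) _ (subset_closure (hD _ ht₁))
      (by rw [_root_.dist_self]; linarith)
    have hB₂ : γ (Real.pi / 6) ∈ B := hmemB _ (hD _ ht₁) (hrad _ ht₁) _ (subset_closure (hD _ ht₂)) (by
      rw [_root_.dist_comm]; linarith)
    have hlt := hηg _ hB₁ _ hB₂ (by linarith)
    rw [hgeq (hD _ ht₁), hgeq (hD _ ht₂), hsy _ ht₁, hsy _ ht₂] at hlt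
    have him := (Complex.abs_im_le_norm _).trans_lt (lt_of_le_of_lt (le_of_eq (dist_eq_norm _ _).symm) hlt)
    rw [Complex.sub_im, (wer_exp_polar s _).2.2, (wer_exp_polar s _).2.2, Real.sin_pi_div_two,
      Real.sin_pi_div_six] at him
    rw [abs_lt] at him
    nlinarith [Real.exp_pos s]
  exact wer_edgeDist_mul_le hF W hγc hγd hfar hAL hZR p hnear


/-- The margin inequality: for `0 < r₁' < r₂'` and `2m ≤ r₁'/4`, `2m ≤ (r₂' - r₁')/8`,
`log (r₂' - 2m) - log (r₁' + 2m) ≥ ½ log (r₂'/r₁')`. [folklore] -/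
theorem wer_log_margin {r₁' r₂' m : ℝ} (h0 : 0 < r₁') (h12 : r₁' < r₂') (hm0 : 0 ≤ m) (hm1 : 8 * m ≤ r₁')
    (hm2 : 16 * m ≤ r₂' - r₁') :
    Real.log (r₂' / r₁') / 2 ≤ Real.log (r₂' - 2 * m) - Real.log (r₁' + 2 * m) := by
  have ha : 0 < r₁' + 2 * m := by linarith
  have hb : 0 < r₂' - 2 * m := by linarith
  have h2 : 0 < r₂' := h0.trans h12
  have hP : 0 < r₁' * r₂' := mul_pos h0 h2
  have key : r₂' * (r₁' + 2 * m) ^ 2 ≤ r₁' * (r₂' - 2 * m) ^ 2 := by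
    have e : r₁' * (r₂' - 2 * m) ^ 2 - r₂' * (r₁' + 2 * m) ^ 2 =
        (r₂' - r₁') * (r₁' * r₂' - (2 * m) ^ 2) - 4 * (r₁' * r₂') * (2 * m) := by ring
    have h4 : 4 * (r₁' * r₂') * (2 * m) ≤ (r₂' - r₁') * (r₁' * r₂') / 2 := by nlinarith
    have h5 : (2 * m) ^ 2 ≤ r₁' * r₂' / 2 := by nlinarith
    nlinarith [mul_nonneg (sub_pos.2 h12).le (show 0 ≤ r₁' * r₂' / 2 - (2 * m) ^ 2 by linarith)]
  have hlog := Real.log_le_log (by positivity) key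
  rw [Real.log_mul h2.ne' (pow_pos ha 2).ne', Real.log_mul h0.ne' (pow_pos hb 2).ne', Real.log_pow,
    Real.log_pow] at hlog
  rw [Real.log_div h2.ne' h0.ne']
  push_cast at hlog
  linarith

/-- **The resistance bound for the window rectangle** (`WindowExtResistanceBound`; the elementary direction
of Chelkak 2016, Prop. 6.2 (i), for the presented window rectangles of the line — see the module docstring;
registered stub of stmt-CriticalPhenomena-10650, line `fk-anchor-transfer`). [folklore] -/
theorem windowExtResistanceBound_holds : WindowExtResistanceBound := by
  intro D φ hφ
  refine ⟨3200000, by norm_num, fun M hM ε hε => ?_⟩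
  have hM0 : 0 < M := one_pos.trans hM
  obtain ⟨r₀, hr₀, hball⟩ := Metric.tendsto_nhdsWithin_nhds.1 hφ.1 ε hε
  refine ⟨r₀ / M, div_pos hr₀ hM0, fun ρ hρ hρ₀ r₁ r₁' r₂' r₂ h01 h11 h12 h22 h2M => ?_⟩
  have hMρ : M * ρ ≤ r₀ := by rw [lt_div_iff₀ hM0] at hρ₀; linarith
  have hball' : ∀ w ∈ upperHalfPlaneSet, ‖w‖ < r₀ → φ w ∈ ball (D.pt 0) ε := fun w hw hwr =>
    hball hw (by rwa [dist_zero_right])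
  -- the margin
  set m : ℝ := min (r₁' / 8) ((r₂' - r₁') / 16) with hm
  have hr₁' : 0 < r₁' := by linarith
  have hm0 : 0 < m := lt_min (by linarith) (by linarith)
  have hm1 : 8 * m ≤ r₁' := by linarith [min_le_left (r₁' / 8) ((r₂' - r₁') / 16)]
  have hm2 : 16 * m ≤ r₂' - r₁' := by linarith [min_le_right (r₁' / 8) ((r₂' - r₁') / 16)]
  set s₁ : ℝ := Real.log (r₁' + 2 * m) with hs₁
  set s₂ : ℝ := Real.log (r₂' - 2 * m) with hs₂
  have hlog0 : 0 < Real.log (r₂' / r₁') := Real.log_pos ((one_lt_div hr₁').2 h12)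
  have hs12 : Real.log (r₂' / r₁') / 2 ≤ s₂ - s₁ := wer_log_margin hr₁' h12 hm0.le hm1 hm2
  have hs : s₁ < s₂ := by linarith
  -- the chart toolkit
  obtain ⟨g, B, η, d, hη, hd, hgeq, hgfr, -, hmemB, hηg, hev⟩ := wer_chart_setup hφ (R := M * ρ) hm0
  filter_upwards [hev, self_mem_nhdsWithin] with δ hδfacts hδ0 Λ _ hΛ E d₀ n hW
  obtain ⟨hδη, hδd, hdeep⟩ := hδfacts
  have hδ : (0 : ℝ) < δ := hδ0
  -- Duffin: bound `dist_W² ≤ (C / log) · area` for every edge metric `W`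
  have hEz : ∀ e ∈ E, e ∈ (zdGraph 2).edgeSet := hW.isRect.subset_edgeSet
  obtain ⟨F, hF⟩ := wer_exists_edgeFinset hEz
  rw [DiscreteRect.extResistance, ← extremalLength_eq_effectiveResistance]
  refine iSup_le fun W => ENNReal.div_le_of_le_mul ?_
  set G := DiscreteRect.extGraph E with hG
  set L := edgeDist G W (DiscreteRect.extArc E d₀ n 0) (DiscreteRect.extArc E d₀ n 2) with hL
  set gh : ℂ → ℝ≥0∞ := fun z => ∑ x ∈ DiscreteRect.verts E, (closedBall (meshPoint δ x) (6 * δ)).indicator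
    (fun _ => ((∑ e ∈ F with Sum.inl x ∈ e, W e : ℝ≥0) : ℝ≥0∞)) z with hgh
  have hghm : Measurable gh := Finset.measurable_sum _ fun x _ => measurable_const.indicator measurableSet_closedBall
  -- per-semicircle bound, averaging, area
  have hper : ∀ s ∈ Ioo s₁ s₂, L * ENNReal.ofReal δ ≤ ∫⁻ θ in Ioo 0 Real.pi,
      gh (φ (exp ((s : ℂ) + (θ : ℂ) * I))) * ‖deriv (fun θ : ℝ => φ (exp ((s : ℂ) + (θ : ℂ) * I))) θ‖ₑ := by
    intro s hs'
    have hs1' : r₁' + 2 * m < Real.exp s := by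
      have := Real.exp_lt_exp.2 hs'.1
      rwa [hs₁, Real.exp_log (by linarith)] at this
    have hs2' : Real.exp s < r₂' - 2 * m := by
      have := Real.exp_lt_exp.2 hs'.2
      rwa [hs₂, Real.exp_log (by linarith)] at this
    exact wer_edgeDist_mul_le_semicircle hW hΛ hδ hgeq hgfr hmemB hηg hδη hδd hdeep hball' hMρ h01 h11.le h22.le
      h2M hm0 hm1 hs1' hs2' (fun e he => (hF e).2 he) W
  have havg := wer_sq_mul_le_lintegral_sq φ hs hghm hper
  have harea : ∫⁻ z, gh z ^ 2 ≤ 400000 * ENNReal.ofReal (δ ^ 2) * networkArea G 1 W :=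
    (wer_lintegral_sq_le hEz (fun e he => (hF e).1 he) W hδ).trans
      (by gcongr; exact wer_sum_sq_le_networkArea G W F fun e he => (hF e).1 he)
  -- bookkeeping
  have hπ4 : ENNReal.ofReal Real.pi ≤ 4 := by
    rw [← ENNReal.ofReal_ofNat 4]; exact ENNReal.ofReal_le_ofReal Real.pi_le_four
  have hl2 : ENNReal.ofReal (Real.log (r₂' / r₁')) ≤ 2 * ENNReal.ofReal (s₂ - s₁) := by
    rw [← ENNReal.ofReal_ofNat 2, ← ENNReal.ofReal_mul (by norm_num)]
    exact ENNReal.ofReal_le_ofReal (by linarith)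
  have key : L ^ 2 * ENNReal.ofReal (Real.log (r₂' / r₁')) * ENNReal.ofReal (δ ^ 2) ≤
      3200000 * networkArea G 1 W * ENNReal.ofReal (δ ^ 2) := by
    calc L ^ 2 * ENNReal.ofReal (Real.log (r₂' / r₁')) * ENNReal.ofReal (δ ^ 2)
        ≤ L ^ 2 * (2 * ENNReal.ofReal (s₂ - s₁)) * ENNReal.ofReal (δ ^ 2) := by gcongr
      _ = 2 * ((L * ENNReal.ofReal δ) ^ 2 * ENNReal.ofReal (s₂ - s₁)) := by
          rw [mul_pow, ← ENNReal.ofReal_pow hδ.le]; ring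
      _ ≤ 2 * (ENNReal.ofReal Real.pi * ∫⁻ z, gh z ^ 2) := by gcongr
      _ ≤ 2 * (4 * (400000 * ENNReal.ofReal (δ ^ 2) * networkArea G 1 W)) := by
          gcongr 2 * ?_; exact mul_le_mul' hπ4 harea
      _ = 3200000 * networkArea G 1 W * ENNReal.ofReal (δ ^ 2) := by ring
  have hδ2 : ENNReal.ofReal (δ ^ 2) ≠ 0 := (ENNReal.ofReal_pos.2 (by positivity)).ne'
  have hl0 : ENNReal.ofReal (Real.log (r₂' / r₁')) ≠ 0 := (ENNReal.ofReal_pos.2 hlog0).ne'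
  have k2 : L ^ 2 * ENNReal.ofReal (Real.log (r₂' / r₁')) ≤ 3200000 * networkArea G 1 W := by
    have := (ENNReal.le_div_iff_mul_le (Or.inl hδ2) (Or.inl ENNReal.ofReal_ne_top)).2 key
    rwa [ENNReal.mul_div_cancel_right hδ2 ENNReal.ofReal_ne_top] at this
  have k3 : L ^ 2 ≤ 3200000 * networkArea G 1 W / ENNReal.ofReal (Real.log (r₂' / r₁')) :=
    (ENNReal.le_div_iff_mul_le (Or.inl hl0) (Or.inl ENNReal.ofReal_ne_top)).2 k2
  calc L ^ 2 ≤ 3200000 * networkArea G 1 W / ENNReal.ofReal (Real.log (r₂' / r₁')) := k3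
    _ = ENNReal.ofReal (3200000 / Real.log (r₂' / r₁')) * networkArea G 1 W := by
        rw [ENNReal.ofReal_div_of_pos hlog0, ENNReal.ofReal_ofNat, ENNReal.div_eq_inv_mul,
          ENNReal.div_eq_inv_mul]; ring

end Summit.CriticalPhenomena.SAWScalingLimit.Theorems.IsingBoundaryRatio

end
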